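import Summits.QuantumFields.QCD.Theorems.PauliWegnerSeaFMClosureUnquenchedTwoStarC1

/-!
# Crux `GaussianLinkFrames.FrameFMClosure` (stmt-QuantumFields-17375), line `pad-the-fibre`, stub
`stub_twoStarOfPadded` — helper 1: ASFH Lemma 4 on an ARBITRARY refit fibre with the cofactor domination supplied
PER FIBRE (region-generic re-run of `VonMisesCirclesC1.fibre_T5`), and the (T5)/(T0) consequences

The landed two-star package (`VonMisesCirclesC1.stub_twoStar`, files `…TwoStarC1` + `Aux1–7`) consumes uniform cofactor
domination through a section hypothesis `hC` asking domination on EVERY super-fibre `R ⊇ star(x) ∪ star(y)`, and the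
fibre band law at `n = 32` links.  The padded statement of this line (`PaddedCofactorDomination`, and any future
variant) only dominates SPECIFIC refit regions (stars plus canonical pad regions, balanced touched region).  This file
re-proves the fibre lemma with exactly the two inputs the proof uses:

* the band law at an arbitrary link budget `n` (hypothesis `hB`: the body of `FibreBandLaw n (4 N_f + 4)` verbatim);
* for ONE fibre (side `A`, sites `a b`, free links `R` with `#R ≤ n`, outside field `U`) the domination inequality
  `‖adj (D_A ⊕ 1)_{ab}‖₁ ≤ C₀ · sup_fibre |det (D_A ⊕ 1)|` (hypothesis `hdom`) — no admissibility, no `a, b ∈ A`, no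
  `R ⊇ stars` is needed by the argument.

Results: `fibre_T5_of_dom` (ASFH Lemma 4 on the fibre), `T5_of_dom` (clause (T5) in side-matrix form with integrability,
given one dominated region of `≤ n` links for `(A, a, b)` and every outside field), `integrable_T0_factor_of_dom`,
`integrable_T0_triple_of_dom` (clause (T0), integrability half).  Proofs are those of `…TwoStarC1Aux5` with `hC …`
replaced by `hdom`.

References: Aizenman–Schenker–Friedrich–Hundertmark, CMP 224 (2001) 219, Lemma 4 and App. A [AizenmanEtAl2001].
-/

noncomputable section

open scoped BigOperators ENNReal
open MeasureTheory
open Literature.MathematicalPhysics.QuantumFieldTheory Literature.MathematicalPhysics.QuantumLattice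
  Literature.Probability.LatticeModels
open Summit.QuantumFields.QCD.Theorems.VonMisesCircles Summit.QuantumFields.QCD.Theorems.VonMisesCirclesC1

namespace Summit.QuantumFields.QCD.Theorems.PadTheFibreTwoStar

section Generic

variable {Nf n : ℕ} {s₁ C₁ p₁ C₀ m₀ : ℝ}

variable (hB : ∀ (N : ℕ) [NeZero N] (R : Finset (Edge 4 N)), R.card ≤ n →
    ∀ (U : GaugeConfig 4 N (Matrix.specialUnitaryGroup (Fin 3) ℂ)) (β : ℝ)
      (P Q : GaugeConfig 4 N (Matrix.specialUnitaryGroup (Fin 3) ℂ) → ℂ),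
      IsFibrePoly (4 * Nf + 4) P → IsFibrePoly (4 * Nf + 4) Q →
      let refit : GaugeConfig 4 N (Matrix.specialUnitaryGroup (Fin 3) ℂ) →
          GaugeConfig 4 N (Matrix.specialUnitaryGroup (Fin 3) ℂ) := fun W e => if e ∈ R then W e else U e
      let wt : GaugeConfig 4 N (Matrix.specialUnitaryGroup (Fin 3) ℂ) → ℝ := fun W =>
        Real.exp (-(β * wilsonAction (fundamentalRep (Fin 3)) (refit W))) * ‖P (refit W)‖
      let haar : Measure (GaugeConfig 4 N (Matrix.specialUnitaryGroup (Fin 3) ℂ)) :=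
        Measure.pi fun _ => haarProbability (Matrix.specialUnitaryGroup (Fin 3) ℂ)
      let Z : ℝ := ∫ W, wt W ∂haar
      (∃ W, P (refit W) ≠ 0) →
        ((∃ W, Q (refit W) ≠ 0) → ∀ᵐ W ∂haar, Q (refit W) ≠ 0) ∧
        (∀ W₀ : GaugeConfig 4 N (Matrix.specialUnitaryGroup (Fin 3) ℂ),
          ‖Q (refit W₀)‖ ≤ C₁ * (1 + |β|) ^ p₁ * ((∫ W, ‖Q (refit W)‖ * wt W ∂haar) / Z)) ∧
        (∀ s : ℝ, 0 < s → s ≤ s₁ →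
          Integrable (fun W => ‖Q (refit W)‖ ^ (-s) * wt W) haar ∧
          (∫ W, ‖Q (refit W)‖ ^ (-s) * wt W ∂haar) / Z ≤
            C₁ * (1 + |β|) ^ p₁ *
              (⨆ W : GaugeConfig 4 N (Matrix.specialUnitaryGroup (Fin 3) ℂ), ‖Q (refit W)‖) ^ (-s)))
  (hC₁ : 0 < C₁) (hC₀ : 0 < C₀)

include hB hC₁ hC₀

/-- **ASFH Lemma 4 on a dominated fibre.**  For ANY side `A`, sites `a, b`, free links `R` with `#R ≤ n`, outside
field `U` and `0 < t ≤ s₁`: if along the `R`-fibre over `U` the `(a,b)` adjugate block of `D_A ⊕ 1` is dominated by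
`C₀ · sup_fibre |det (D_A ⊕ 1)|`, then `∫ e^{-βS}|det 𝔇| ‖G_A(a,b)‖₁^t ≤ C₀^t C₁(1+|β|)^{p₁} ∫ e^{-βS}|det 𝔇|` over the
fibre (Cramer + domination + (Neg); the suprema cancel). [cite: AizenmanEtAl2001, Lemma 4] -/
theorem fibre_T5_of_dom {S : ℕ} (β : ℝ) (mq : Fin Nf → ℝ) (A : Finset (TorusSite 4 (2 * S + 1)))
    (a b : TorusSite 4 (2 * S + 1)) (R : Finset (Edge 4 (2 * S + 1))) (hRcard : R.card ≤ n)
    (t : ℝ) (ht : 0 < t) (hts : t ≤ s₁) (U : GaugeConfig 4 (2 * S + 1) (Matrix.specialUnitaryGroup (Fin 3) ℂ))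
    (hdom : ∀ W : GaugeConfig 4 (2 * S + 1) (Matrix.specialUnitaryGroup (Fin 3) ℂ),
      blockNorm ((sideMatrix A (wilsonD (fun e => if e ∈ R then W e else U e) m₀)).adjugate) a b ≤
        C₀ * ⨆ W' : GaugeConfig 4 (2 * S + 1) (Matrix.specialUnitaryGroup (Fin 3) ℂ),
          ‖(sideMatrix A (wilsonD (fun e => if e ∈ R then W' e else U e) m₀)).det‖) :
    ∫⁻ W, ENNReal.ofReal (Real.exp (-(β * wilsonAction (fundamentalRep (Fin 3))
          (fun e => if e ∈ R then W e else U e))) *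
        ‖(diracMatrix (fun e => if e ∈ R then W e else U e) mq).det‖ *
        blockNorm (gside A (wilsonD (fun e => if e ∈ R then W e else U e) m₀)) a b ^ t)
      ∂(Measure.pi fun _ : Edge 4 (2 * S + 1) => haarProbability (Matrix.specialUnitaryGroup (Fin 3) ℂ)) ≤
    ENNReal.ofReal (C₀ ^ t * (C₁ * (1 + |β|) ^ p₁)) *
      ∫⁻ W, ENNReal.ofReal (Real.exp (-(β * wilsonAction (fundamentalRep (Fin 3))
          (fun e => if e ∈ R then W e else U e))) *
        ‖(diracMatrix (fun e => if e ∈ R then W e else U e) mq).det‖)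
      ∂(Measure.pi fun _ : Edge 4 (2 * S + 1) => haarProbability (Matrix.specialUnitaryGroup (Fin 3) ℂ)) := by
  -- abbreviations
  set T : GaugeConfig 4 (2 * S + 1) (Matrix.specialUnitaryGroup (Fin 3) ℂ) →
      GaugeConfig 4 (2 * S + 1) (Matrix.specialUnitaryGroup (Fin 3) ℂ) := fun W e => if e ∈ R then W e else U e
    with hTdef
  set haar : Measure (GaugeConfig 4 (2 * S + 1) (Matrix.specialUnitaryGroup (Fin 3) ℂ)) :=
    Measure.pi fun _ => haarProbability (Matrix.specialUnitaryGroup (Fin 3) ℂ) with hhaar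
  set P : GaugeConfig 4 (2 * S + 1) (Matrix.specialUnitaryGroup (Fin 3) ℂ) → ℂ := fun V => (diracMatrix V mq).det
    with hPdef
  set Q : GaugeConfig 4 (2 * S + 1) (Matrix.specialUnitaryGroup (Fin 3) ℂ) → ℂ := fun V =>
    (sideMatrix A (wilsonD V m₀)).det with hQdef
  set wt : GaugeConfig 4 (2 * S + 1) (Matrix.specialUnitaryGroup (Fin 3) ℂ) → ℝ := fun W =>
    Real.exp (-(β * wilsonAction (fundamentalRep (Fin 3)) (T W))) * ‖P (T W)‖ with hwtdef
  have hTm : Measurable T := measurable_refit R U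
  have hTc : Continuous T := continuous_refit R U
  have hP : IsFibrePoly (4 * Nf + 4) P := fibrePoly_mono (isFibrePoly_det_diracMatrix mq) (by omega)
  have hQ : IsFibrePoly (4 * Nf + 4) Q := fibrePoly_mono (isFibrePoly_sideDet A m₀) (by omega)
  have hwt0 : ∀ W, 0 ≤ wt W := fun W => mul_nonneg (Real.exp_pos _).le (norm_nonneg _)
  have hwti : Integrable wt haar := integrable_weight_refit β mq R U
  have hSm := measurable_wilsonAction (d := 4) (L := 2 * S + 1) (fundamentalRep (Fin 3))
    (continuous_fundamentalRep (Fin 3))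
  have hwtm : Measurable wt :=
    (Real.measurable_exp.comp ((hSm.comp hTm).const_mul β).neg).mul (hP.1.measurable.comp hTm).norm
  -- the goal in the abbreviations
  change ∫⁻ W, ENNReal.ofReal (wt W * blockNorm (gside A (wilsonD (T W) m₀)) a b ^ t) ∂haar ≤
    ENNReal.ofReal (C₀ ^ t * (C₁ * (1 + |β|) ^ p₁)) * ∫⁻ W, ENNReal.ofReal (wt W) ∂haar
  -- degenerate fibre: the tilt vanishes identically
  by_cases hPex : ∃ W, P (T W) ≠ 0
  swap
  · push Not at hPex
    have h0 : ∀ W, wt W = 0 := fun W => by rw [hwtdef]; simp [hPex W]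
    calc ∫⁻ W, ENNReal.ofReal (wt W * blockNorm (gside A (wilsonD (T W) m₀)) a b ^ t) ∂haar
        = ∫⁻ _W, 0 ∂haar := lintegral_congr fun W => by rw [h0 W, zero_mul, ENNReal.ofReal_zero]
      _ ≤ _ := by rw [lintegral_zero]; exact bot_le
  -- the supremum of `|det D_A|` over the fibre
  have hQc : Continuous fun W => ‖Q (T W)‖ := (hQ.1.comp hTc).norm
  have hbdd : BddAbove (Set.range fun W => ‖Q (T W)‖) := (isCompact_range hQc).bddAbove
  set M : ℝ := ⨆ W, ‖Q (T W)‖ with hMdef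
  have hM0 : 0 ≤ M := Real.iSup_nonneg fun W => norm_nonneg _
  have hleM : ∀ W, ‖Q (T W)‖ ≤ M := fun W => le_ciSup hbdd W
  rcases hM0.lt_or_eq with hMpos | hM0'
  swap
  · -- `det D_A ≡ 0` on the fibre: the Green function is the junk `0`
    have hdet : ∀ W, (sideMatrix A (wilsonD (T W) m₀)).det = 0 := fun W =>
      norm_eq_zero.1 (le_antisymm (hM0' ▸ hleM W) (norm_nonneg _))
    have h0 : ∀ W, blockNorm (gside A (wilsonD (T W) m₀)) a b ^ t = 0 := fun W => by
      rw [gside, blockNorm_inv_of_det_eq_zero _ _ _ (hdet W), Real.zero_rpow ht.ne']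
    calc ∫⁻ W, ENNReal.ofReal (wt W * blockNorm (gside A (wilsonD (T W) m₀)) a b ^ t) ∂haar
        = ∫⁻ _W, 0 ∂haar := lintegral_congr fun W => by rw [h0 W, mul_zero, ENNReal.ofReal_zero]
      _ ≤ _ := by rw [lintegral_zero]; exact bot_le
  -- (Neg) for `Q = det (D_A ⊕ 1)` at exponent `t`
  have hNeg : Integrable (fun W => ‖Q (T W)‖ ^ (-t) * wt W) haar ∧
      (∫ W, ‖Q (T W)‖ ^ (-t) * wt W ∂haar) / (∫ W, wt W ∂haar) ≤ C₁ * (1 + |β|) ^ p₁ * M ^ (-t) :=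
    (hB (2 * S + 1) R hRcard U β P Q hP hQ hPex).2.2 t ht hts
  -- pointwise: Cramer + domination
  have hpt : ∀ W, wt W * blockNorm (gside A (wilsonD (T W) m₀)) a b ^ t ≤
      (C₀ * M) ^ t * (‖Q (T W)‖ ^ (-t) * wt W) := by
    intro W
    rw [gside, blockNorm_inv_rpow]
    have hadj : blockNorm (sideMatrix A (wilsonD (T W) m₀)).adjugate a b ≤ C₀ * M := hdom W
    have h1 : blockNorm (sideMatrix A (wilsonD (T W) m₀)).adjugate a b ^ t ≤ (C₀ * M) ^ t :=
      Real.rpow_le_rpow (blockNorm_nonneg _ _ _) hadj ht.le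
    have h2 : 0 ≤ ‖(sideMatrix A (wilsonD (T W) m₀)).det‖ ^ (-t) := Real.rpow_nonneg (norm_nonneg _) _
    calc wt W * (blockNorm (sideMatrix A (wilsonD (T W) m₀)).adjugate a b ^ t *
          ‖(sideMatrix A (wilsonD (T W) m₀)).det‖ ^ (-t))
        ≤ wt W * ((C₀ * M) ^ t * ‖(sideMatrix A (wilsonD (T W) m₀)).det‖ ^ (-t)) :=
          mul_le_mul_of_nonneg_left (mul_le_mul_of_nonneg_right h1 h2) (hwt0 W)
      _ = (C₀ * M) ^ t * (‖Q (T W)‖ ^ (-t) * wt W) := by rw [hQdef]; ring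
  have hCM : 0 ≤ (C₀ * M) ^ t := Real.rpow_nonneg (mul_nonneg hC₀.le hM0) _
  have hmeas : Measurable fun W => ENNReal.ofReal (‖Q (T W)‖ ^ (-t) * wt W) :=
    ((hQc.measurable.pow_const _).mul hwtm).ennreal_ofReal
  have hB0 : 0 ≤ C₁ * (1 + |β|) ^ p₁ * M ^ (-t) :=
    mul_nonneg (mul_nonneg hC₁.le (Real.rpow_nonneg (by positivity) _)) (Real.rpow_nonneg hM0 _)
  have hkey := lintegral_ofReal_mul_le_of_div_le haar hwt0 (fun W => Real.rpow_nonneg (norm_nonneg _) _)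
    hwti hNeg.1 hB0 hNeg.2
  calc ∫⁻ W, ENNReal.ofReal (wt W * blockNorm (gside A (wilsonD (T W) m₀)) a b ^ t) ∂haar
      ≤ ∫⁻ W, ENNReal.ofReal ((C₀ * M) ^ t) * ENNReal.ofReal (‖Q (T W)‖ ^ (-t) * wt W) ∂haar := by
        refine lintegral_mono fun W => ?_
        rw [← ENNReal.ofReal_mul hCM]
        exact ENNReal.ofReal_le_ofReal (hpt W)
    _ = ENNReal.ofReal ((C₀ * M) ^ t) * ∫⁻ W, ENNReal.ofReal (‖Q (T W)‖ ^ (-t) * wt W) ∂haar :=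
        lintegral_const_mul _ hmeas
    _ ≤ ENNReal.ofReal ((C₀ * M) ^ t) * (ENNReal.ofReal (C₁ * (1 + |β|) ^ p₁ * M ^ (-t)) *
          ∫⁻ W, ENNReal.ofReal (wt W) ∂haar) := by
        gcongr
    _ = ENNReal.ofReal (C₀ ^ t * (C₁ * (1 + |β|) ^ p₁)) * ∫⁻ W, ENNReal.ofReal (wt W) ∂haar := by
        rw [← mul_assoc, ← ENNReal.ofReal_mul hCM]
        congr 2
        have hMt : M ^ t ≠ 0 := (Real.rpow_pos_of_pos hMpos t).ne'
        rw [Real.mul_rpow hC₀.le hM0, Real.rpow_neg hM0]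
        field_simp

/-- `fibre_T5_of_dom` for the full Green function `D⁻¹` (`A = univ`; the domination hypothesis is stated with
`sideMatrix univ`, literally the `A = univ` instance of a side-wise domination statement). [cite: AizenmanEtAl2001, Lemma 4] -/
theorem fibre_T5_inv_of_dom {S : ℕ} (β : ℝ) (mq : Fin Nf → ℝ) (a b : TorusSite 4 (2 * S + 1))
    (R : Finset (Edge 4 (2 * S + 1))) (hRcard : R.card ≤ n)
    (t : ℝ) (ht : 0 < t) (hts : t ≤ s₁) (U : GaugeConfig 4 (2 * S + 1) (Matrix.specialUnitaryGroup (Fin 3) ℂ))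
    (hdom : ∀ W : GaugeConfig 4 (2 * S + 1) (Matrix.specialUnitaryGroup (Fin 3) ℂ),
      blockNorm ((sideMatrix Finset.univ (wilsonD (fun e => if e ∈ R then W e else U e) m₀)).adjugate) a b ≤
        C₀ * ⨆ W' : GaugeConfig 4 (2 * S + 1) (Matrix.specialUnitaryGroup (Fin 3) ℂ),
          ‖(sideMatrix Finset.univ (wilsonD (fun e => if e ∈ R then W' e else U e) m₀)).det‖) :
    ∫⁻ W, ENNReal.ofReal (Real.exp (-(β * wilsonAction (fundamentalRep (Fin 3))
          (fun e => if e ∈ R then W e else U e))) *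
        ‖(diracMatrix (fun e => if e ∈ R then W e else U e) mq).det‖ *
        blockNorm (wilsonD (fun e => if e ∈ R then W e else U e) m₀)⁻¹ a b ^ t)
      ∂(Measure.pi fun _ : Edge 4 (2 * S + 1) => haarProbability (Matrix.specialUnitaryGroup (Fin 3) ℂ)) ≤
    ENNReal.ofReal (C₀ ^ t * (C₁ * (1 + |β|) ^ p₁)) *
      ∫⁻ W, ENNReal.ofReal (Real.exp (-(β * wilsonAction (fundamentalRep (Fin 3))
          (fun e => if e ∈ R then W e else U e))) *
        ‖(diracMatrix (fun e => if e ∈ R then W e else U e) mq).det‖)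
      ∂(Measure.pi fun _ : Edge 4 (2 * S + 1) => haarProbability (Matrix.specialUnitaryGroup (Fin 3) ℂ)) := by
  have h := fibre_T5_of_dom hB hC₁ hC₀ β mq Finset.univ a b R hRcard t ht hts U hdom
  simp_rw [gside_univ] at h
  exact h

/-- **Clause (T5), side-matrix form, from ONE dominated region.**  If some region `R` of `≤ n` links carries the
domination inequality for `(A, a, b)` along its fibre over EVERY outside field, then for `0 < t ≤ s₁`:
`pqE[‖G_A(a,b)‖₁^t] ≤ C₀^t C₁ (1+|β|)^{p₁}` and `|det 𝔇| ‖G_A(a,b)‖₁^t` is `μ_W`-integrable (tower property over the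
outside, `pqE_le_of_fibre_bound`). [cite: AizenmanEtAl2001, Lemma 4] -/
theorem T5_of_dom {S : ℕ} (β : ℝ) (mq : Fin Nf → ℝ) (A : Finset (TorusSite 4 (2 * S + 1)))
    (a b : TorusSite 4 (2 * S + 1)) (R : Finset (Edge 4 (2 * S + 1))) (hRcard : R.card ≤ n)
    (hdom : ∀ U W : GaugeConfig 4 (2 * S + 1) (Matrix.specialUnitaryGroup (Fin 3) ℂ),
      blockNorm ((sideMatrix A (wilsonD (fun e => if e ∈ R then W e else U e) m₀)).adjugate) a b ≤
        C₀ * ⨆ W' : GaugeConfig 4 (2 * S + 1) (Matrix.specialUnitaryGroup (Fin 3) ℂ),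
          ‖(sideMatrix A (wilsonD (fun e => if e ∈ R then W' e else U e) m₀)).det‖)
    (t : ℝ) (ht : 0 < t) (hts : t ≤ s₁) :
    pqE Nf S β mq (fun U => blockNorm (gside A (wilsonD U m₀)) a b ^ t) ≤ C₀ ^ t * (C₁ * (1 + |β|) ^ p₁) ∧
      Integrable (fun U => ‖(diracMatrix U mq).det‖ * blockNorm (gside A (wilsonD U m₀)) a b ^ t)
        (wilsonMeasure (d := 4) (L := 2 * S + 1) (fundamentalRep (Fin 3)) β) :=
  pqE_le_of_fibre_bound β mq _ (fun U => Real.rpow_nonneg (blockNorm_nonneg _ _ _) _)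
    ((measurable_blockNorm_gside A m₀ a b).pow_const t)
    (mul_nonneg (Real.rpow_nonneg hC₀.le _) (mul_nonneg hC₁.le (Real.rpow_nonneg (by positivity) _))) R
    fun U => fibre_T5_of_dom hB hC₁ hC₀ β mq A a b R hRcard t ht hts U (hdom U)

/-- **Clause (T5) of `TwoStarBounds`** (`A = univ`) from one dominated region of `≤ n` links for `(univ, x, y)`:
`pqE[‖D⁻¹(x,y)‖₁^t] ≤ C₀^t C₁ (1+|β|)^{p₁}` for `0 < t ≤ s₁`, with integrability. [cite: AizenmanEtAl2001, Lemma 4] -/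
theorem T5_inv_of_dom {S : ℕ} (β : ℝ) (mq : Fin Nf → ℝ) (x y : TorusSite 4 (2 * S + 1))
    (R : Finset (Edge 4 (2 * S + 1))) (hRcard : R.card ≤ n)
    (hdom : ∀ U W : GaugeConfig 4 (2 * S + 1) (Matrix.specialUnitaryGroup (Fin 3) ℂ),
      blockNorm ((sideMatrix Finset.univ (wilsonD (fun e => if e ∈ R then W e else U e) m₀)).adjugate) x y ≤
        C₀ * ⨆ W' : GaugeConfig 4 (2 * S + 1) (Matrix.specialUnitaryGroup (Fin 3) ℂ),
          ‖(sideMatrix Finset.univ (wilsonD (fun e => if e ∈ R then W' e else U e) m₀)).det‖)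
    (t : ℝ) (ht : 0 < t) (hts : t ≤ s₁) :
    pqE Nf S β mq (fun U => blockNorm (wilsonD U m₀)⁻¹ x y ^ t) ≤ C₀ ^ t * (C₁ * (1 + |β|) ^ p₁) ∧
      Integrable (fun U => ‖(diracMatrix U mq).det‖ * blockNorm (wilsonD U m₀)⁻¹ x y ^ t)
        (wilsonMeasure (d := 4) (L := 2 * S + 1) (fundamentalRep (Fin 3)) β) := by
  have h := T5_of_dom hB hC₁ hC₀ β mq Finset.univ x y R hRcard hdom t ht hts
  simp_rw [gside_univ] at h
  exact h

/-- **Clause (T0), one factor.**  `|det 𝔇| ‖G_A(a,b)‖₁^t` is `μ_W`-integrable for `0 ≤ t ≤ s₁`, provided that when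
`a, b ∈ A` some region of `≤ n` links dominates `(A, a, b)` (outside `A × A` the side-wise Green function is bounded by
`144`). [cite: AizenmanEtAl2001, Lemma 4] -/
theorem integrable_T0_factor_of_dom {S : ℕ} (β : ℝ) (mq : Fin Nf → ℝ) (A : Finset (TorusSite 4 (2 * S + 1)))
    (a b : TorusSite 4 (2 * S + 1))
    (hdomA : a ∈ A → b ∈ A → ∃ R : Finset (Edge 4 (2 * S + 1)), R.card ≤ n ∧
      ∀ U W : GaugeConfig 4 (2 * S + 1) (Matrix.specialUnitaryGroup (Fin 3) ℂ),
        blockNorm ((sideMatrix A (wilsonD (fun e => if e ∈ R then W e else U e) m₀)).adjugate) a b ≤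
          C₀ * ⨆ W' : GaugeConfig 4 (2 * S + 1) (Matrix.specialUnitaryGroup (Fin 3) ℂ),
            ‖(sideMatrix A (wilsonD (fun e => if e ∈ R then W' e else U e) m₀)).det‖)
    (t : ℝ) (ht0 : 0 ≤ t) (hts : t ≤ s₁) :
    Integrable (fun U => ‖(diracMatrix U mq).det‖ * blockNorm (gside A (wilsonD U m₀)) a b ^ t)
      (wilsonMeasure (d := 4) (L := 2 * S + 1) (fundamentalRep (Fin 3)) β) := by
  rcases ht0.lt_or_eq with ht | ht
  · by_cases hab : a ∈ A ∧ b ∈ A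
    · obtain ⟨R, hRcard, hdom⟩ := hdomA hab.1 hab.2
      exact (T5_of_dom hB hC₁ hC₀ β mq A a b R hRcard hdom t ht hts).2
    · have hbd : ∀ U : GaugeConfig 4 (2 * S + 1) (Matrix.specialUnitaryGroup (Fin 3) ℂ),
          blockNorm (gside A (wilsonD U m₀)) a b ^ t ≤ (144 : ℝ) ^ t := fun U =>
        Real.rpow_le_rpow (blockNorm_nonneg _ _ _) (blockNorm_gside_le_of_not_mem A _ a b (not_and_or.1 hab))
          ht.le
      refine ((integrable_norm_det_diracMatrix mq _).mul_const ((144 : ℝ) ^ t)).mono' ?_ ?_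
      · exact ((measurable_norm_det_diracMatrix mq).mul
          ((measurable_blockNorm_gside A m₀ a b).pow_const t)).aestronglyMeasurable
      · refine ae_of_all _ fun U => ?_
        rw [Real.norm_eq_abs, abs_of_nonneg (mul_nonneg (norm_nonneg _)
          (Real.rpow_nonneg (blockNorm_nonneg _ _ _) _))]
        exact mul_le_mul_of_nonneg_left (hbd U) (norm_nonneg _)
  · subst ht
    simp only [Real.rpow_zero, mul_one]
    exact integrable_norm_det_diracMatrix mq _

/-- **Clause (T0) of `TwoStarBounds`, integrability half, from dominated regions**: the (≤ 3)-fold products of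
fractional powers (exponents in `[0, s₁/3]`) of block norms of side-wise Green functions are integrable against the
phase-quenched weight, provided each factor with both sites on its side has a dominated region of `≤ n` links.
[cite: AizenmanEtAl2001, Lemma 4] -/
theorem integrable_T0_triple_of_dom {S : ℕ} (β : ℝ) (mq : Fin Nf → ℝ) (t₁ t₂ t₃ : ℝ)
    (h₁ : 0 ≤ t₁) (h₁' : 3 * t₁ ≤ s₁) (h₂ : 0 ≤ t₂) (h₂' : 3 * t₂ ≤ s₁) (h₃ : 0 ≤ t₃) (h₃' : 3 * t₃ ≤ s₁)
    (A₁ A₂ A₃ : Finset (TorusSite 4 (2 * S + 1))) (a₁ b₁ a₂ b₂ a₃ b₃ : TorusSite 4 (2 * S + 1))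
    (hd₁ : a₁ ∈ A₁ → b₁ ∈ A₁ → ∃ R : Finset (Edge 4 (2 * S + 1)), R.card ≤ n ∧
      ∀ U W : GaugeConfig 4 (2 * S + 1) (Matrix.specialUnitaryGroup (Fin 3) ℂ),
        blockNorm ((sideMatrix A₁ (wilsonD (fun e => if e ∈ R then W e else U e) m₀)).adjugate) a₁ b₁ ≤
          C₀ * ⨆ W' : GaugeConfig 4 (2 * S + 1) (Matrix.specialUnitaryGroup (Fin 3) ℂ),
            ‖(sideMatrix A₁ (wilsonD (fun e => if e ∈ R then W' e else U e) m₀)).det‖)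
    (hd₂ : a₂ ∈ A₂ → b₂ ∈ A₂ → ∃ R : Finset (Edge 4 (2 * S + 1)), R.card ≤ n ∧
      ∀ U W : GaugeConfig 4 (2 * S + 1) (Matrix.specialUnitaryGroup (Fin 3) ℂ),
        blockNorm ((sideMatrix A₂ (wilsonD (fun e => if e ∈ R then W e else U e) m₀)).adjugate) a₂ b₂ ≤
          C₀ * ⨆ W' : GaugeConfig 4 (2 * S + 1) (Matrix.specialUnitaryGroup (Fin 3) ℂ),
            ‖(sideMatrix A₂ (wilsonD (fun e => if e ∈ R then W' e else U e) m₀)).det‖)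
    (hd₃ : a₃ ∈ A₃ → b₃ ∈ A₃ → ∃ R : Finset (Edge 4 (2 * S + 1)), R.card ≤ n ∧
      ∀ U W : GaugeConfig 4 (2 * S + 1) (Matrix.specialUnitaryGroup (Fin 3) ℂ),
        blockNorm ((sideMatrix A₃ (wilsonD (fun e => if e ∈ R then W e else U e) m₀)).adjugate) a₃ b₃ ≤
          C₀ * ⨆ W' : GaugeConfig 4 (2 * S + 1) (Matrix.specialUnitaryGroup (Fin 3) ℂ),
            ‖(sideMatrix A₃ (wilsonD (fun e => if e ∈ R then W' e else U e) m₀)).det‖) :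
    Integrable (fun U : GaugeConfig 4 (2 * S + 1) (Matrix.specialUnitaryGroup (Fin 3) ℂ) =>
      ‖(diracMatrix U mq).det‖ *
        (blockNorm (gside A₁ (wilsonD U m₀)) a₁ b₁ ^ t₁ *
          blockNorm (gside A₂ (wilsonD U m₀)) a₂ b₂ ^ t₂ *
          blockNorm (gside A₃ (wilsonD U m₀)) a₃ b₃ ^ t₃))
      (wilsonMeasure (d := 4) (L := 2 * S + 1) (fundamentalRep (Fin 3)) β) := by
  have g₁ := integrable_T0_factor_of_dom hB hC₁ hC₀ β mq A₁ a₁ b₁ hd₁ (3 * t₁) (by linarith) h₁'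
  have g₂ := integrable_T0_factor_of_dom hB hC₁ hC₀ β mq A₂ a₂ b₂ hd₂ (3 * t₂) (by linarith) h₂'
  have g₃ := integrable_T0_factor_of_dom hB hC₁ hC₀ β mq A₃ a₃ b₃ hd₃ (3 * t₃) (by linarith) h₃'
  refine ((g₁.add g₂).add g₃).mono' ?_ (ae_of_all _ fun U => ?_)
  · exact ((measurable_norm_det_diracMatrix mq).mul
      ((((measurable_blockNorm_gside A₁ m₀ a₁ b₁).pow_const t₁).mul
        ((measurable_blockNorm_gside A₂ m₀ a₂ b₂).pow_const t₂)).mul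
        ((measurable_blockNorm_gside A₃ m₀ a₃ b₃).pow_const t₃))).aestronglyMeasurable
  · have hx := Real.rpow_nonneg (blockNorm_nonneg (gside A₁ (wilsonD U m₀)) a₁ b₁) t₁
    have hy := Real.rpow_nonneg (blockNorm_nonneg (gside A₂ (wilsonD U m₀)) a₂ b₂) t₂
    have hz := Real.rpow_nonneg (blockNorm_nonneg (gside A₃ (wilsonD U m₀)) a₃ b₃) t₃
    have hcube := mul_mul_le_cube_add _ _ _ hx hy hz
    rw [rpow_pow_three _ _ (blockNorm_nonneg _ _ _), rpow_pow_three _ _ (blockNorm_nonneg _ _ _),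
      rpow_pow_three _ _ (blockNorm_nonneg _ _ _)] at hcube
    rw [Real.norm_eq_abs, abs_of_nonneg (mul_nonneg (norm_nonneg _) (mul_nonneg (mul_nonneg hx hy) hz))]
    simp only [Pi.add_apply]
    calc ‖(diracMatrix U mq).det‖ *
          (blockNorm (gside A₁ (wilsonD U m₀)) a₁ b₁ ^ t₁ * blockNorm (gside A₂ (wilsonD U m₀)) a₂ b₂ ^ t₂ *
            blockNorm (gside A₃ (wilsonD U m₀)) a₃ b₃ ^ t₃)
        ≤ ‖(diracMatrix U mq).det‖ *
          (blockNorm (gside A₁ (wilsonD U m₀)) a₁ b₁ ^ (3 * t₁) + blockNorm (gside A₂ (wilsonD U m₀)) a₂ b₂ ^ (3 * t₂) +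
            blockNorm (gside A₃ (wilsonD U m₀)) a₃ b₃ ^ (3 * t₃)) :=
          mul_le_mul_of_nonneg_left hcube (norm_nonneg _)
      _ = _ := by ring

end Generic

/-- **Registered helper `stub_twoStarOfPadded_aux1` of crux stmt-QuantumFields-17375** (line `pad-the-fibre`, stub
`stub_twoStarOfPadded`): clause (T5) in side-matrix form, with integrability, from the fibre band law at `n` links and ONE
region of `≤ n` links dominating `(A, a, b)` over every outside field — the form in which any region-wise cofactor
domination (two-star K1♭, padded, …) is consumed. [cite: AizenmanEtAl2001, Lemma 4] -/
theorem stub_twoStarOfPadded_aux1 : ∀ (n Nf : ℕ) (C₀ : ℝ), 0 < C₀ → FibreBandLaw → ∃ s₁ K p : ℝ, 0 < s₁ ∧ 0 < K ∧ ∀ (S : ℕ) (β m₀ : ℝ) (mq : Fin Nf → ℝ) (A : Finset (TorusSite 4 (2 * S + 1))) (a b : TorusSite 4 (2 * S + 1)) (R : Finset (Edge 4 (2 * S + 1))), R.card ≤ n → (∀ U W : GaugeConfig 4 (2 * S + 1) (Matrix.specialUnitaryGroup (Fin 3) ℂ), blockNorm ((sideMatrix A (wilsonD (fun e => if e ∈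 R then W e else U e) m₀)).adjugate) a b ≤ C₀ * ⨆ W' : GaugeConfig 4 (2 * S + 1) (Matrix.specialUnitaryGroup (Fin 3) ℂ), ‖(sideMatrix A (wilsonD (fun e => if e ∈ R then W' e else U e) m₀)).det‖) → ∀ (t : ℝ), 0 < t → t ≤ s₁ → pqE Nf S β mq (fun U => blockNorm (gside A (wilsonD U m₀)) a b ^ t) ≤ K ^ t * (K * (1 + |β|) ^ p) ∧ Integrable (fun U => ‖(diracMatrix U mq).det‖ * blockNorm (gside A (wilsonD U m₀)) a b ^ t) (wilsonMeasure (d := 4) (L := 2 * S + 1) (fundamentalRep (Fin 3)) β) := by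
  intro n Nf C₀ hC₀ hFBL
  obtain ⟨sB, C₁, p₁, hsB, hC₁, hB⟩ := hFBL n (4 * Nf + 4)
  refine ⟨sB, max C₀ C₁, p₁, hsB, lt_max_of_lt_left hC₀, ?_⟩
  intro S β m₀ mq A a b R hRcard hdom t ht hts
  have h := T5_of_dom (m₀ := m₀) hB hC₁ hC₀ β mq A a b R hRcard hdom t ht hts
  refine ⟨h.1.trans ?_, h.2⟩
  have hB0 : 0 ≤ (1 + |β|) ^ p₁ := Real.rpow_nonneg (by positivity) _
  exact mul_le_mul (Real.rpow_le_rpow hC₀.le (le_max_left _ _) ht.le)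
    (mul_le_mul_of_nonneg_right (le_max_right _ _) hB0) (mul_nonneg hC₁.le hB0)
    (Real.rpow_nonneg (hC₀.le.trans (le_max_left _ _)) _)

end Summit.QuantumFields.QCD.Theorems.PadTheFibreTwoStar
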